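import Summits.Langlands.Langlands.Theorems.ParityBlindBianchiTwoAdicBianchiProModularityLevelBridge
import Literature.NumberTheory.Automorphic.RegularAlgebraicCuspidalHeckePointAssembly
import HarnessLib

/-!
# `TwoAdicBianchiProModularityLevel` (stmt-Langlands-15110) — the crux modulo its three printed/open inputs

Item `Summit.Langlands.Langlands.Theses.ParityBlindBianchi.TwoAdicBianchiProModularityLevel` (E2′ of route
ParityBlindBianchi).  The line `Sketch` reduced the crux to two registered stubs, (A-raw)
`stub_classicalHeckePoint` and (B) `stub_artinLift`, and the tree meanwhile reduced (A-raw) — through the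
Literature named fact `bianchi_regularAlgebraicCuspidal_isHeckePoint` and its landed assembly
`bianchi_regularAlgebraicCuspidal_isHeckePoint_of_eigenclassExists_of_typeFL` (Scholze's Cor. V.4.2 assembled
in Lean) — to the two theorems in print behind it.  This file records, sorry-free and in ONE declaration of the
`Theorems` tree, the resulting terminal shape of the item:

  **E2′ ⇐ (ESH) ∧ (FL) ∧ (B)**, where

* (ESH) `bianchi_cuspidal_regularLAlgebraic_eigenclassExists` — Eichler–Shimura–Harder: a regular algebraic
  cuspidal `π` of `GL₂` over an imaginary quadratic field occurs as a Hecke eigenclass in the cohomology of a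
  Bianchi space with the algebraic coefficient system of its weight (Literature named fact, theorem in print,
  unproved in the tree) [Harder1987], [Clozel1990, 3.14];
* (FL) Borel–Serre, as printed: torsion-free arithmetic subgroups of `GL_n(K)` are of type `FL` — every
  trivial module has a projective resolution by finitely generated free modules (explicit hypothesis, the shape
  used by the tree's `…_of_typeFL_torsionFree` reductions; theorem in print, unproved in the tree)
  [BorelSerre1973, §11.1 (c), 11.6];
* (B) the ARTIN LIFT — residual occurrence of the Hansen data of the icosahedral finite-image `σ` in some
  `𝕋(U₀²)` implies their occurrence as a point of some `Spf 𝕋(U²)`, `U` hyperspecial off `S₀`: big `R = 𝕋`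
  for `GL₂/K` in defect `l₀ = 1` at `p = 2`, read at the Artin point (the registered stub `stub_artinLift`
  verbatim; OPEN PROBLEM: Gee–Newton Conj. 60 / Prop. 62, Calegari–Geraghty Thm. 1.1, Hansen Conj. 1.2.3).

Proof: the Literature assembly gives the named fact (A) from (ESH) and (FL); the landed bridge
`TwoAdicBianchiProModularityLevel_of_artinLift` (p108612) gives the crux from (A) and (B).  Nothing else is
used.  (Lead c12 of the line; the thirteen seats c0–c12 and the crux's disprover concur that (B) is the open
mathematical content of E2′ and that no formal escape exists in either direction.)
-/

noncomputable section

set_option linter.dupNamespace false -- `Summit.Langlands.Langlands` is the mandated namespace (D-0017)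

open scoped NumberField MatrixGroups
open Polynomial IsDedekindDomain Field CategoryTheory
open Literature.NumberTheory.GaloisRepresentations Literature.NumberTheory.Automorphic

namespace Summit.Langlands.Langlands.Theorems.TwoAdicBianchiProModularityLevel

/-- **E2′ modulo its three inputs: `TwoAdicBianchiProModularityLevel` follows from Eichler–Shimura–Harder
eigenclass existence (ESH, the Literature named fact `bianchi_cuspidal_regularLAlgebraic_eigenclassExists`),
Borel–Serre type `FL` for torsion-free arithmetic subgroups of `GL_n(K)` (FL, explicit hypothesis as printed),
and the Artin lift (B, the registered stub `stub_artinLift` verbatim: big `R = 𝕋` for `GL₂/K`, `l₀ = 1`,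
`p = 2`, read at the Artin point — open problem).**  Composition of the Literature assembly
`bianchi_regularAlgebraicCuspidal_isHeckePoint_of_eigenclassExists_of_typeFL` (fact (A) ⇐ ESH + FL) with the
landed bridge `TwoAdicBianchiProModularityLevel_of_artinLift` (crux ⇐ (A) ∧ (B)).
[cite: Scholze2015, §V.4, Cor. V.4.2] [cite: BorelSerre1973, §11.1 (c), 11.6] [cite: Harder1987]
[cite: GeeNewton2020, §5.1, Conj. 60 and Prop. 62] -/
theorem TwoAdicBianchiProModularityLevel_of_eigenclassExists_of_typeFL_of_artinLift : ∀ (hX : Literature.NumberTheory.Automorphic.bianchi_cuspidal_regularLAlgebraic_eigenclassExists) (hFL : ∀ (k : Type) [CommRing k] (n : ℕ) (K : Type) [Field K] [NumberField K] (Γ : Subgroup (GL (Fin n) K)), Γ.Commensurable (Matrix.GeneralLinearGroup.map (algebraMap (𝓞 K) K) : GL (Fin n) (𝓞 K) →* GL (Fin n) K).range → (∀ g : Γ, IsOfFinOrder g → g = 1) → ∃ P : ProjectiveResolution (Rep.trivial k Γ k), ∀ i, ∃ m : ℕ, Nonempty (P.complex.X i ≅ Rep.free k Γ (Fin m))) (hB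 : ∀ (K : Type) [Field K] [NumberField K], NumberField.IsTotallyComplex K → Module.finrank ℚ K = 2 → (∃ v w : HeightOneSpectrum (𝓞 K), v ≠ w ∧ ((2 : ℕ) : 𝓞 K) ∈ v.asIdeal ∧ ((2 : ℕ) : 𝓞 K) ∈ w.asIdeal) → ∀ (σ : FramedGaloisRep K (PadicAlgCl 2) 2), Finite σ.toMonoidHom.range → σ.toGaloisRep.IsIrreducible → Nonempty ((Matrix.ProjGenLinGroup.mk.comp σ.toMonoidHom).range ≃* alternatingGroup (Fin 5)) → ∀ S₀ : Finset ℕ, 2 ∈ S₀ → ∀ (ϖ : ∀ v : HeightOneSpectrum (𝓞 K), (v.adicCompletion K)ˣ), (∀ v : HeightOneSpectrum (𝓞 K), Valued.v ((ϖ v : (v.adicCompletion K)ˣ) : v.adicCompletion K) = WithZero.exp (-1 : ℤ)) → ∀ (a : {v : HeightOneSpectrum (𝓞 K) // ∀ ℓ ∈ S₀, ((ℓ : ℕ) : 𝓞 K) ∉ v.asIdeal} → ℕ → (PadicAlgCl.valued 2).v.valuationSubring), (∀ (v : HeightOneSpectrum (𝓞 K)) (hv : ∀ ℓ ∈ S₀,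 ((ℓ : ℕ) : 𝓞 K) ∉ v.asIdeal), σ.IsHeckeAssociatedAt v (fun i : ℕ => if i = 0 then (1 : PadicAlgCl 2) else ((a ⟨v, hv⟩ i : (PadicAlgCl.valued 2).v.valuationSubring) : PadicAlgCl 2))) → (∃ U₀ : Subgroup (GL (Fin 2) (FiniteAdeleRing (𝓞 K) K)), IsOpen (U₀ : Set (GL (Fin 2) (FiniteAdeleRing (𝓞 K) K))) ∧ U₀ ≤ glFiniteIntegralLevel 2 K ∧ (∀ g ∈ glFiniteIntegralLevel 2 K, (∀ v : HeightOneSpectrum (𝓞 K), ¬ (∀ ℓ ∈ S₀, ((ℓ : ℕ) : 𝓞 K) ∉ v.asIdeal) → ∀ i j : Fin 2, ((g : Matrix (Fin 2) (Fin 2) (FiniteAdeleRing (𝓞 K) K)) i j) v = (1 : Matrix (Fin 2) (Fin 2) (v.adicCompletion K)) i j) → g ∈ U₀) ∧ ∃ b : {v : HeightOneSpectrum (𝓞 K) // ∀ ℓ ∈ S₀, ((ℓ : ℕ) : 𝓞 K) ∉ v.asIdeal} → ℕ → (PadicAlgCl.valued 2).v.valuationSubring, (∀ j : {v : HeightOneSpectrum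 (𝓞 K) // ∀ ℓ ∈ S₀, ((ℓ : ℕ) : 𝓞 K) ∉ v.asIdeal} × Fin 2, ‖((b j.1 (j.2.val + 1) : (PadicAlgCl.valued 2).v.valuationSubring) : PadicAlgCl 2) - ((a j.1 (j.2.val + 1) : (PadicAlgCl.valued 2).v.valuationSubring) : PadicAlgCl 2)‖ < 1) ∧ IsHeckePoint (Matrix.GeneralLinearGroup.map (algebraMap K (FiniteAdeleRing (𝓞 K) K)) : GL (Fin 2) K →* GL (Fin 2) (FiniteAdeleRing (𝓞 K) K)) (LevelTower.ofSeq U₀ (fun r : ℕ => (principalCongruenceLevel 2 K (Ideal.span {((2 : ℕ) : 𝓞 K)} ^ r)).map (GLn.sndHom 2 K))) ((2 : ℕ) : (PadicAlgCl.valued 2).v.valuationSubring) (fun j : {v : HeightOneSpectrum (𝓞 K) // ∀ ℓ ∈ S₀, ((ℓ : ℕ) : 𝓞 K) ∉ v.asIdeal} × Fin 2 => GLn.sndHom 2 K (heckeDiagAt 2 K j.1.1 (ϖ j.1.1) (j.2.val + 1))) (fun j => b j.1 (j.2.val + 1))) → ∃ U : Subgroup (GL (Fin 2) (FiniteAdeleRing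 (𝓞 K) K)), IsOpen (U : Set (GL (Fin 2) (FiniteAdeleRing (𝓞 K) K))) ∧ U ≤ glFiniteIntegralLevel 2 K ∧ (∀ g ∈ glFiniteIntegralLevel 2 K, (∀ v : HeightOneSpectrum (𝓞 K), ¬ (∀ ℓ ∈ S₀, ((ℓ : ℕ) : 𝓞 K) ∉ v.asIdeal) → ∀ i j : Fin 2, ((g : Matrix (Fin 2) (Fin 2) (FiniteAdeleRing (𝓞 K) K)) i j) v = (1 : Matrix (Fin 2) (Fin 2) (v.adicCompletion K)) i j) → g ∈ U) ∧ IsHeckePoint (Matrix.GeneralLinearGroup.map (algebraMap K (FiniteAdeleRing (𝓞 K) K)) : GL (Fin 2) K →* GL (Fin 2) (FiniteAdeleRing (𝓞 K) K)) (LevelTower.ofSeq U (fun r : ℕ => (principalCongruenceLevel 2 K (Ideal.span {((2 : ℕ) : 𝓞 K)} ^ r)).map (GLn.sndHom 2 K))) ((2 : ℕ) : (PadicAlgCl.valued 2).v.valuationSubring) (fun j : {v : HeightOneSpectrum (𝓞 K) // ∀ ℓ ∈ S₀, ((ℓ : ℕ) : 𝓞 K) ∉ v.asIdeal} × Fin 2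 => GLn.sndHom 2 K (heckeDiagAt 2 K j.1.1 (ϖ j.1.1) (j.2.val + 1))) (fun j => a j.1 (j.2.val + 1))), Summit.Langlands.Langlands.Theses.ParityBlindBianchi.TwoAdicBianchiProModularityLevel :=
  fun hX hFL hB =>
  TwoAdicBianchiProModularityLevel_of_artinLift
    (Literature.NumberTheory.Automorphic.bianchi_regularAlgebraicCuspidal_isHeckePoint_of_eigenclassExists_of_typeFL
      hX hFL)
    hB

end Summit.Langlands.Langlands.Theorems.TwoAdicBianchiProModularityLevel

end
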